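import Summits.Schanuel.Schanuel.Theorems.DiophantineDichotomyKhovanskiiApproxTypeEvDefs
import Literature.NumberTheory.Transcendental.GammaPointsDense
import Literature.Barriers.Schanuel.LargeTranscendenceDegreeSmallTrdegProofs
import HarnessLib

/-!
# Route `DiophantineDichotomy`, crux `KhovanskiiApproxTypeEv`, line `anchored-reduction`:
# stub `stub_unanchoring` — Schanuel on anchored tuples `(1, iπ, …)` gives Schanuel

Crux `Summit.Schanuel.Schanuel.Theses.DiophantineDichotomy.KhovanskiiApproxTypeEv`
(item stmt-Schanuel-14972), line `anchored-reduction` (skeleton of line lead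
`prover-line-stmt-Schanuel-14972-0`), registered stub `stub_unanchoring` (`--supports`):
`SchanuelAnchored → Schanuel`, the un-anchoring half of the anchored reduction
`KhovanskiiReductionAnchored = stub_unanchoring ∘ stub_anchoredReduction`.

## Proof

Write `K(S) = ℚ(S, exp S)` and `t(S) = trdeg_ℚ K(S)` for `S ⊆ ℂ`.  The one transcendence fact is
`trdeg_le_of_subset_span`: if `S ⊆ span_ℚ T` then `t(S) ≤ t(T)` — every `s ∈ span_ℚ T` lies in
`ℚ(T)` and `exp s` is algebraic over `K(T)` (`exp(s)^M = ∏ exp(t)^{m_t}` for a denominator `M`), so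
`K(S)` lies in the relative algebraic closure of `K(T)` in `ℂ`, which has the transcendence degree
of `K(T)`.  Given a `ℚ`-linearly independent `z : Fin n → ℂ`, adjoin the anchor `1` if it is not in
`span_ℚ z` (`t` grows by `≤ 1` since `1` is algebraic, the length by `1`) and do nothing otherwise;
same with `iπ` (`exp(iπ) = -1` is algebraic).  The resulting independent tuple `z₂` of length `n₂`
has `t(z₂) + n ≤ t(z) + n₂` and `1, iπ ∈ V = span_ℚ z₂`, `dim V = n₂`.  Extending `(1, iπ)` inside
`V` to a basis `w = (1, iπ, w₂, …)` of `V` (`exists_linearIndependent_snoc_of_lt_finrank`),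
`SchanuelAnchored` gives `n₂ ≤ t(w) ≤ t(z₂)` (`range w ⊆ span z₂`), whence `n ≤ t(z)`.

## Contents

* `stub_unanchoring` — the registered stub, by name (helpers are private).
-/

noncomputable section

-- `Summit.Schanuel.Schanuel.…` is the mandated summit/sub-problem namespace (single-conjunct summit), hence:
set_option linter.dupNamespace false

namespace Summit.Schanuel.Schanuel.Cruxes.KhovanskiiApproxTypeEv.AnchoredReduction

open Complex IntermediateField
open Literature.Barriers.Schanuel (trdeg_mono trdeg_adjoin_union_eq_of_isAlgebraic
  trdeg_adjoin_singleton_le_one)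
open Literature.NumberTheory.Transcendental (trdeg_le_of_isAlgebraic)

-- Note on the `ℚ`-algebra diamond on subfields of `ℂ` (`DivisionRing.toRatAlgebra`, found here by
-- instance search, vs the generic `IntermediateField.algebra'` of the imported lemmas): the two are
-- defeq, so generic lemmas are applied with `exact`/`trans` (unification), never with `rw`.

/-! ## Transcendence-degree tools -/

/-- Adjoining one element raises the transcendence degree by at most one:
`trdeg_K K(S ∪ {b}) ≤ trdeg_K K(S) + 1` (tower `K ⊆ K(S) ⊆ K(S)(b) = K(S ∪ {b})` and
`trdeg_{K(S)} K(S)(b) ≤ 1`). [folklore] -/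
private theorem trdeg_adjoin_insert_le_add_one {K E : Type*} [Field K] [Field E] [Algebra K E]
    (S : Set E) (b : E) :
    Algebra.trdeg K (adjoin K (insert b S)) ≤ Algebra.trdeg K (adjoin K S) + 1 := by
  haveI : FaithfulSMul (adjoin K S) (adjoin (adjoin K S) ({b} : Set E)) :=
    (faithfulSMul_iff_algebraMap_injective _ _).2
      (algebraMap (adjoin K S) (adjoin (adjoin K S) ({b} : Set E))).injective
  have htower := trdeg_add_eq K (adjoin K S) (A := adjoin (adjoin K S) ({b} : Set E))
  have heq : Algebra.trdeg K (adjoin (adjoin K S) ({b} : Set E)) =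
      Algebra.trdeg K (adjoin K (insert b S)) := by
    rw [← Set.union_singleton, ← (equivOfEq (adjoin_adjoin_left K S {b})).trdeg_eq]
    rfl
  rw [← heq, ← htower]
  gcongr
  exact trdeg_adjoin_singleton_le_one _

/-- If `s ∈ span_ℚ T` then `s` and `exp s` lie in the relative algebraic closure `M` of
`L = ℚ(T, exp T)` in `ℂ`: `s ∈ ℚ(T) ⊆ L`, and for `s = ∑ qᵢ tᵢ` with common denominator `d`,
`exp(s)^d` is a Laurent monomial in the `exp tᵢ ∈ L`, so `exp s` is algebraic over `L`
(induction on the span: `exp(x + y) = exp x · exp y`, `exp(q x)^{den q} = exp(x)^{num q}`).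
[folklore] -/
private theorem mem_and_exp_mem_of_mem_span (T : Set ℂ) {s : ℂ} (hs : s ∈ Submodule.span ℚ T) :
    s ∈ (algebraicClosure (adjoin ℚ (T ∪ cexp '' T)) ℂ).restrictScalars ℚ ∧
      cexp s ∈ (algebraicClosure (adjoin ℚ (T ∪ cexp '' T)) ℂ).restrictScalars ℚ := by
  set L := adjoin ℚ (T ∪ cexp '' T)
  set M := (algebraicClosure L ℂ).restrictScalars ℚ
  have hLM : ∀ x ∈ L, x ∈ M := fun x hx =>
    (mem_restrictScalars ℚ).2 (mem_algebraicClosure_iff.2 (isAlgebraic_algebraMap (⟨x, hx⟩ : L)))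
  induction hs using Submodule.span_induction with
  | mem x hx =>
    exact ⟨hLM x (subset_adjoin ℚ _ (Or.inl hx)), hLM _ (subset_adjoin ℚ _ (Or.inr ⟨x, hx, rfl⟩))⟩
  | zero => exact ⟨zero_mem M, by rw [Complex.exp_zero]; exact one_mem M⟩
  | add x y _ _ hx hy =>
    exact ⟨add_mem hx.1 hy.1, by rw [Complex.exp_add]; exact mul_mem hx.2 hy.2⟩
  | smul q x _ hx =>
    refine ⟨M.smul_mem hx.1, ?_⟩
    have hpow : cexp (q • x) ^ q.den = cexp x ^ q.num := by
      rw [← Complex.exp_nat_mul, ← Complex.exp_int_mul, Rat.smul_def, ← mul_assoc]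
      congr 2
      have h := Rat.den_mul_eq_num q
      exact_mod_cast congrArg (Rat.cast : ℚ → ℂ) h
    have halg : IsAlgebraic L (cexp (q • x) ^ q.den) := by
      rw [hpow]
      exact mem_algebraicClosure_iff.1 ((mem_restrictScalars ℚ).1 (zpow_mem hx.2 _))
    exact (mem_restrictScalars ℚ).2 (mem_algebraicClosure_iff.2 (IsAlgebraic.of_pow q.den_pos halg))

/-- **`t(S) ≤ t(T)` whenever `S ⊆ span_ℚ T`**, where `t(S) = trdeg_ℚ ℚ(S, exp S)`: the field
`ℚ(S, exp S)` lies in the relative algebraic closure of `ℚ(T, exp T)` in `ℂ`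
(`mem_and_exp_mem_of_mem_span`), whose transcendence degree is that of `ℚ(T, exp T)`
(`trdeg_le_of_isAlgebraic`). [folklore] -/
private theorem trdeg_le_of_subset_span {S T : Set ℂ} (h : S ⊆ Submodule.span ℚ T) :
    Algebra.trdeg ℚ (adjoin ℚ (S ∪ cexp '' S)) ≤ Algebra.trdeg ℚ (adjoin ℚ (T ∪ cexp '' T)) := by
  set L := adjoin ℚ (T ∪ cexp '' T)
  set M := (algebraicClosure L ℂ).restrictScalars ℚ
  have hLM : L ≤ M := fun x hx =>
    (mem_restrictScalars ℚ).2 (mem_algebraicClosure_iff.2 (isAlgebraic_algebraMap (⟨x, hx⟩ : L)))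
  have hSM : adjoin ℚ (S ∪ cexp '' S) ≤ M := by
    rw [adjoin_le_iff]
    rintro x (hx | ⟨s, hs, rfl⟩)
    · exact (mem_and_exp_mem_of_mem_span T (h hx)).1
    · exact (mem_and_exp_mem_of_mem_span T (h hs)).2
  exact (trdeg_mono hSM).trans
    (trdeg_le_of_isAlgebraic hLM fun x hx =>
      mem_algebraicClosure_iff.1 ((mem_restrictScalars ℚ).1 hx))

/-! ## Anchoring one element -/

/-- ONE ANCHORING STEP.  For `a` with `a` or `exp a` algebraic over `ℚ` and a linearly independent
`z : Fin m → ℂ` there is a linearly independent `z'` of length `m' ≥ m` with `a ∈ span_ℚ z'`,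
`range z ⊆ range z'` and `t(z') + m ≤ t(z) + m'`: if `a ∈ span_ℚ z` take `z' = z`, otherwise
`z' = (a, z)` (then `ℚ(z', exp z') = ℚ(z, exp z)(a, exp a)` with one of `a`, `exp a` algebraic, so
`t` grows by at most one, `trdeg_adjoin_insert_le_add_one`). [folklore] -/
private theorem anchor_step {a : ℂ} (ha : IsAlgebraic ℚ a ∨ IsAlgebraic ℚ (cexp a)) {m : ℕ}
    (z : Fin m → ℂ) (hz : LinearIndependent ℚ z) :
    ∃ (m' : ℕ) (z' : Fin m' → ℂ), LinearIndependent ℚ z' ∧ a ∈ Submodule.span ℚ (Set.range z') ∧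
      Set.range z ⊆ Set.range z' ∧ m ≤ m' ∧
      Algebra.trdeg ℚ (adjoin ℚ (Set.range z' ∪ Set.range (cexp ∘ z'))) + m ≤
        Algebra.trdeg ℚ (adjoin ℚ (Set.range z ∪ Set.range (cexp ∘ z))) + m' := by
  by_cases hmem : a ∈ Submodule.span ℚ (Set.range z)
  · exact ⟨m, z, hz, hmem, subset_rfl, le_rfl, le_rfl⟩
  refine ⟨m + 1, Fin.cons a z, hz.finCons hmem, Submodule.subset_span ⟨0, Fin.cons_zero _ _⟩, ?_,
    m.le_succ, ?_⟩
  · rw [Fin.range_cons]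
    exact Set.subset_insert _ _
  · have key : ∀ (b c : ℂ) (X : Set ℂ), IsAlgebraic ℚ b →
        Algebra.trdeg ℚ (adjoin ℚ (insert b (insert c X))) ≤ Algebra.trdeg ℚ (adjoin ℚ X) + 1 := by
      intro b c X hb
      rw [← Set.union_singleton (a := b)]
      exact (trdeg_adjoin_union_eq_of_isAlgebraic _ _
        (fun x hx => by rwa [Set.mem_singleton_iff.1 hx])).trans_le
          (trdeg_adjoin_insert_le_add_one X c)
    have hG : Set.range (Fin.cons a z : Fin (m + 1) → ℂ) ∪ Set.range (cexp ∘ Fin.cons a z) =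
        insert a (insert (cexp a) (Set.range z ∪ Set.range (cexp ∘ z))) := by
      rw [Fin.comp_cons, Fin.range_cons, Fin.range_cons, Set.insert_union, Set.union_insert]
    have hle : Algebra.trdeg ℚ (adjoin ℚ (Set.range (Fin.cons a z : Fin (m + 1) → ℂ) ∪
        Set.range (cexp ∘ Fin.cons a z))) ≤
        Algebra.trdeg ℚ (adjoin ℚ (Set.range z ∪ Set.range (cexp ∘ z))) + 1 := by
      rw [hG]
      rcases ha with ha | ha
      · exact key _ _ _ ha
      · rw [Set.insert_comm]
        exact key _ _ _ ha
    calc Algebra.trdeg ℚ (adjoin ℚ (Set.range (Fin.cons a z : Fin (m + 1) → ℂ) ∪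
          Set.range (cexp ∘ Fin.cons a z))) + m
          ≤ (Algebra.trdeg ℚ (adjoin ℚ (Set.range z ∪ Set.range (cexp ∘ z))) + 1) + m := by
          gcongr
      _ = Algebra.trdeg ℚ (adjoin ℚ (Set.range z ∪ Set.range (cexp ∘ z))) +
          ((m + 1 : ℕ) : Cardinal) := by
          rw [Nat.cast_succ, add_assoc, add_comm (1 : Cardinal)]

/-! ## An anchored basis of a subspace containing `1, iπ` -/

/-- `1` and `iπ` are `ℚ`-linearly independent (real and imaginary parts). [folklore] -/
private theorem linearIndependent_one_I_pi : LinearIndependent ℚ ![(1 : ℂ), I * Real.pi] := by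
  rw [LinearIndependent.pair_iff]
  intro s t hst
  have hre := congrArg Complex.re hst
  have him := congrArg Complex.im hst
  simp only [Complex.add_re, Complex.add_im, Complex.smul_re, Complex.smul_im, Complex.mul_re,
    Complex.mul_im, Complex.ofReal_re, Complex.ofReal_im, Complex.I_re, Complex.I_im,
    Complex.one_re, Complex.one_im, Complex.zero_re, Complex.zero_im, mul_zero, zero_mul,
    one_mul, add_zero, zero_add, smul_zero, sub_self] at hre him
  refine ⟨?_, ?_⟩
  · rw [Rat.smul_def, mul_one] at hre
    exact_mod_cast hre
  · rw [Rat.smul_def, mul_eq_zero] at him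
    rcases him with h | h
    · exact_mod_cast h
    · exact absurd h Real.pi_ne_zero

/-- The pair `(1, iπ)` inside a `ℚ`-subspace `V ∋ 1, iπ` is linearly independent. [folklore] -/
private theorem linearIndependent_anchors (V : Submodule ℚ ℂ) (h1 : (1 : ℂ) ∈ V)
    (hpi : I * Real.pi ∈ V) : LinearIndependent ℚ ![(⟨1, h1⟩ : V), ⟨I * Real.pi, hpi⟩] := by
  refine LinearIndependent.of_comp V.subtype ?_
  have : (V.subtype ∘ ![(⟨1, h1⟩ : V), ⟨I * Real.pi, hpi⟩] : Fin 2 → ℂ) =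
      ![(1 : ℂ), I * Real.pi] := by
    ext i
    fin_cases i <;> rfl
  rw [this]
  exact linearIndependent_one_I_pi

/-- In a `ℚ`-subspace `V ∋ 1, iπ` of `ℂ` of dimension `≥ j + 2` there is a linearly independent
`(j+2)`-tuple `(1, iπ, u₂, …)` of elements of `V` (extend one vector at a time,
`exists_linearIndependent_snoc_of_lt_finrank`). [folklore] -/
private theorem exists_anchored_tuple (V : Submodule ℚ ℂ) (h1 : (1 : ℂ) ∈ V)
    (hpi : I * Real.pi ∈ V) (j : ℕ) (hj : j + 2 ≤ Module.finrank ℚ V) :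
    ∃ u : Fin (j + 2) → V, LinearIndependent ℚ u ∧ (u 0 : ℂ) = 1 ∧ (u 1 : ℂ) = I * Real.pi := by
  induction j with
  | zero => exact ⟨_, linearIndependent_anchors V h1 hpi, rfl, rfl⟩
  | succ j ih =>
    obtain ⟨u, hu, hu0, hu1⟩ := ih (by omega)
    obtain ⟨x, hx⟩ := exists_linearIndependent_snoc_of_lt_finrank hu (by omega)
    refine ⟨Fin.snoc u x, hx, ?_, ?_⟩
    · rw [show (0 : Fin (j + 1 + 2)) = Fin.castSucc (0 : Fin (j + 2)) from rfl, Fin.snoc_castSucc]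
      exact hu0
    · rw [show (1 : Fin (j + 1 + 2)) = Fin.castSucc (1 : Fin (j + 2)) from rfl, Fin.snoc_castSucc]
      exact hu1

/-! ## The stub -/

/-- **Un-anchoring** (`stub_unanchoring` of the skeleton): Schanuel's conjecture on anchored tuples
`(1, iπ, x₂, …)` implies Schanuel's conjecture.  For `z : Fin n → ℂ` linearly independent, anchor
`1` and then `iπ` (`anchor_step`: adjoin the anchor if it is outside the `ℚ`-span — `t` grows by at
most one, the length by one — and keep the tuple otherwise), obtaining an independent `z₂` of
length `n₂` with `t(z₂) + n ≤ t(z) + n₂` and `1, iπ ∈ V = span_ℚ z₂`, `dim V = n₂`; a basis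
`w = (1, iπ, …)` of `V` (`exists_anchored_tuple`) has `n₂ ≤ t(w)` by the hypothesis and
`t(w) ≤ t(z₂)` (`trdeg_le_of_subset_span`), so `n ≤ t(z)`. [folklore] -/
theorem stub_unanchoring : SchanuelAnchored → _root_.Schanuel := by
  intro hA n z hz
  have hIpi : IsAlgebraic ℚ (cexp (I * Real.pi)) := by
    rw [mul_comm, Complex.exp_pi_mul_I]
    exact isAlgebraic_one.neg
  obtain ⟨n₁, z₁, hz₁, h1, -, -, ht₁⟩ := anchor_step (a := 1) (Or.inl isAlgebraic_one) z hz
  obtain ⟨n₂, z₂, hz₂, hpi, hsub, -, ht₂⟩ := anchor_step (a := I * Real.pi) (Or.inr hIpi) z₁ hz₁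
  have h1' : (1 : ℂ) ∈ Submodule.span ℚ (Set.range z₂) := Submodule.span_mono hsub h1
  set V := Submodule.span ℚ (Set.range z₂) with hV
  haveI : FiniteDimensional ℚ V := FiniteDimensional.span_of_finite ℚ (Set.finite_range z₂)
  have hdim : Module.finrank ℚ V = n₂ := by rw [hV, finrank_span_eq_card hz₂, Fintype.card_fin]
  have h2 : 2 ≤ n₂ := by
    simpa [hdim] using (linearIndependent_anchors V h1' hpi).fintype_card_le_finrank
  obtain ⟨k, hk⟩ : ∃ k, n₂ = k + 2 := ⟨n₂ - 2, by omega⟩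
  obtain ⟨u, hu, hu0, hu1⟩ := exists_anchored_tuple V h1' hpi k (by omega)
  set w : Fin (k + 2) → ℂ := fun i => (u i : ℂ)
  have hw : LinearIndependent ℚ w := hu.map' V.subtype (Submodule.ker_subtype V)
  have hAw : ((k + 2 : ℕ) : Cardinal) ≤
      Algebra.trdeg ℚ (adjoin ℚ (Set.range w ∪ Set.range (cexp ∘ w))) := hA k w hu0 hu1 hw
  have hwV : Set.range w ⊆ Submodule.span ℚ (Set.range z₂) := by
    rintro _ ⟨i, rfl⟩
    exact (u i).2
  have ht₃ := trdeg_le_of_subset_span hwV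
  rw [← Set.range_comp, ← Set.range_comp] at ht₃
  have key : (n : Cardinal) + ((n₁ + n₂ : ℕ) : Cardinal) ≤
      Algebra.trdeg ℚ (adjoin ℚ (Set.range z ∪ Set.range (cexp ∘ z))) +
        ((n₁ + n₂ : ℕ) : Cardinal) :=
    calc (n : Cardinal) + ((n₁ + n₂ : ℕ) : Cardinal)
        = ((k + 2 : ℕ) : Cardinal) + n₁ + n := by rw [← hk]; push_cast; ring
      _ ≤ Algebra.trdeg ℚ (adjoin ℚ (Set.range w ∪ Set.range (cexp ∘ w))) + n₁ + n := by
          gcongr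
      _ ≤ Algebra.trdeg ℚ (adjoin ℚ (Set.range z₂ ∪ Set.range (cexp ∘ z₂))) + n₁ + n := by
          gcongr
      _ ≤ Algebra.trdeg ℚ (adjoin ℚ (Set.range z₁ ∪ Set.range (cexp ∘ z₁))) + n₂ + n := by
          gcongr ?_ + _
      _ = Algebra.trdeg ℚ (adjoin ℚ (Set.range z₁ ∪ Set.range (cexp ∘ z₁))) + n + n₂ := by ring
      _ ≤ Algebra.trdeg ℚ (adjoin ℚ (Set.range z ∪ Set.range (cexp ∘ z))) + n₁ + n₂ := by
          gcongr ?_ + _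
      _ = _ := by push_cast; ring
  exact (Cardinal.add_nat_le_add_nat_iff (n₁ + n₂)).1 key

end Summit.Schanuel.Schanuel.Cruxes.KhovanskiiApproxTypeEv.AnchoredReduction

end
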